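/-
NEXT RUNG beyond LRAD for crux item stmt-PneNP-18538 (`StrongComposition`, C1) — planner-pnp-ideate-p4, gen 19,
answering director-frontier 2026-08-29T09:22:46Z («name the smallest adversary class strictly beyond LRAD on which
StrongComposition is open and what the gluing invariant lacks there; one candidate stub signature»).
DEFINITIONS + STATEMENTS ONLY (no stubs, no sorry).  FRONTIER work; nothing here bears on `P ≠ NP`.
-/
import Mathlib
import Summits.PneNP.PneNP.Theses.KrwChromaticSteering
import Literature.Computability.Complexity.KRWComposition

/-!
# Beyond LRAD: the classes `LRB ⊊ LRX_t` and the candidate stubs `LRBQuantitative`, `LRXQuantitative`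

LRAD (rung PROVED, `Lines/lrad_gluing.lean` v3) = label tests ∨ affine tests ∨ single-row tests, rows typed online
`algebraic` (touched by an affine test) / `combinatorial` (touched by a single-row test), never both on one path.
Only two node patterns lie outside LRAD:

* **type B** — a single-row test on an ALGEBRAIC row `i` (load `λ ≥ 1` equations of the path pass through it);
* **type A** — an affine test whose support touches a COMBINATORIAL row (already cut by a non-affine row test).

Diagnosis (memo `LensBarrierP4g19.md` v6 §6.0).  Type B is conjecturally FREE for the gluing invariant `InvOnE`
once `g` is also *subspace-hard* (`SubspaceHard g q` below, obtainable by the S0 counting): split every equation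
through row `i` at the row boundary (fix the internal parity `γ` from the satisfying assignment at hand — per-row
LOADS are unchanged, so the per-row budget `k`, the label hardness `ℓ` and `K` do not move), move the `λ` internal
equations into both players' row-sets (`S_i = T_i = V_i`, an affine subspace of codim `≤ λ`; `AE` is unchanged by
affine genericity), lower `K` to `min K k ≤ q − λ ≤ D_KW(g|V_i)` (free, the potential is `ℓ + min K k`), retype the
row `combinatorial` — the LRAD invariant is restored with the same potential.  Type A is NOT free: the product
structure of the fibred state forces the adversary to decouple (reveal the internal parity on the combinatorial row
by an M3 row step, `≤ 1` unit) before the external part is an LRAD-legal affine step (`≤ 1` unit): two units for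
one protocol bit, i.e. **one extra unit per combinatorial row touched**.  Hence the typing below: a single-row test
weighs `0` on every row (the row becomes combinatorial), an affine test weighs the number of combinatorial rows it
touches (those rows stay combinatorial), a label test weighs `0`; `LRX_t` = total weight `≤ t` on every path;
`LRB := LRX_0 ⊋ LRAD` (equations-then-row-tests per row, in that order only).  Rungs: `StrongCompositionLRB`
(C1's loss, no `t`) and `StrongCompositionLRX` (loss `+ t`); stubs `LRBQuantitative`, `LRXQuantitative`; support
`jointSubspaceHard_exists` (S0⁺).  The class with teeth stays LRA = unbounded type-A weight, where `+ t` is useless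
and a non-product (coupled) state is required — that is the re-located twist-debt obstruction (memo §2.3, O6).
DEFINITIONS AND STATEMENTS ONLY.  FRONTIER work; nothing here bears on `P ≠ NP`.
-/

set_option linter.dupNamespace false
set_option autoImplicit false

namespace Summit.PneNP.PneNP.Cruxes.StrongComposition.P4g19X

open Literature.Computability.Complexity

universe u

section Vocabulary

variable {ι : Type u} {m n : ℕ}

/-- [verbatim `LabelPublic.SolvesRect`] -/
def SolvesRect (Q : KWTree ι) (A B : Set (ι → Bool)) : Prop :=
  ∀ a ∈ A, ∀ b ∈ B, a (Q.run a b) ≠ b (Q.run a b)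

/-- [verbatim `LabelPublic.Hard`] -/
def Hard (A B : Set (ι → Bool)) (ℓ : ℕ) : Prop :=
  ∀ Q : KWTree ι, SolvesRect Q A B → ℓ ≤ Q.depth

/-- [verbatim `P4g18.parityOn`] -/
def parityOn (S : Finset (Fin m × Fin n)) (X : Fin m × Fin n → Bool) : Bool :=
  Nat.bodd (S.filter fun p => X p = true).card

/-- [verbatim `P4g18.IsLabelTest`] -/
def IsLabelTest (g : (Fin n → Bool) → Bool) (s : (Fin m × Fin n → Bool) → Bool) : Prop :=
  ∃ φ : (Fin m → Bool) → Bool, ∀ X, s X = φ (rowLabels g X)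

/-- [verbatim `P4g18.AffSys`] -/
abbrev AffSys (m n : ℕ) := List (Finset (Fin m × Fin n) × Bool)

/-- [verbatim `P4g18.Sat`] -/
def Sat (E : AffSys m n) (X : Fin m × Fin n → Bool) : Prop := ∀ e ∈ E, parityOn e.1 X = e.2

/-- [verbatim `P4g19.eqRows`] -/
def eqRows (S : Finset (Fin m × Fin n)) : Finset (Fin m) := S.image Prod.fst

/-- [verbatim `P4g19.rowLoad`] -/
def rowLoad (E : AffSys m n) (i : Fin m) : ℕ := (E.filter fun e => i ∈ eqRows e.1).length

/-- [verbatim `P4g19.PerRowLU`] label-universality under per-row load `≤ q`. -/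
def PerRowLU (g : (Fin n → Bool) → Bool) (m q : ℕ) : Prop :=
  ∀ E : AffSys m n, (∀ i, rowLoad E i ≤ q) → (∃ X, Sat E X) →
    ∀ v : Fin m → Bool, ∃ X, Sat E X ∧ rowLabels g X = v

/-- [verbatim `P4g18.rowParity`] parity of a row vector on `S ⊆ [n]`. -/
def rowParity (S : Finset (Fin n)) (x : Fin n → Bool) : Bool := Nat.bodd (S.filter fun j => x j = true).card

/-- [verbatim `P4g18.AffGeneric`] `r`-affine-genericity of `g` by equations. -/
def AffGeneric (g : (Fin n → Bool) → Bool) (r : ℕ) : Prop :=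
  ∀ E : List (Finset (Fin n) × Bool), E.length + r + 1 ≤ n →
    (∃ x, ∀ e ∈ E, rowParity e.1 x = e.2) → ∀ β : Bool, ∃ x, (∀ e ∈ E, rowParity e.1 x = e.2) ∧ g x = β

/-- **NEW SUPPORT NOTION (S0⁺).** `g` is *subspace-hard with budget `q`*: on every affine subspace
`V = {x | F x}` of `{0,1}^n` cut out by `λ ≤ q` parity equations, the Karchmer–Wigderson game of `g|_V` has depth
`≥ q − λ`.  (`λ = 0`: `D_KW(g) ≥ q`.)  By counting, a uniformly random `g` has it for `q = n − O(log n)` jointly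
with `AffGeneric` — the statement `jointSubspaceHard_exists` below. -/
def SubspaceHard (g : (Fin n → Bool) → Bool) (q : ℕ) : Prop :=
  ∀ F : List (Finset (Fin n) × Bool), F.length ≤ q →
    Hard {x | (∀ e ∈ F, rowParity e.1 x = e.2) ∧ g x = true}
         {x | (∀ e ∈ F, rowParity e.1 x = e.2) ∧ g x = false} (q - F.length)

/-- **S0⁺ (support, counting; the analogue of the proved `jointHardGeneric_exists`).** -/
def jointSubspaceHard_exists : Prop :=
  ∃ c : ℕ, ∀ n : ℕ, c * (Nat.log 2 n + 1) + 1 ≤ n →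
    ∃ g : (Fin n → Bool) → Bool,
      AffGeneric g (c * (Nat.log 2 n + 1)) ∧ SubspaceHard g (n - c * (Nat.log 2 n + 1) - 1)

end Vocabulary

section Crossing

variable {m n : ℕ}

/-- Row types WITH LOADS: `algebraic λ` = touched by `λ` equations of the path, no single-row test yet. -/
inductive RowTypeX
  | fresh
  | algebraic (load : ℕ)
  | combinatorial
  deriving DecidableEq

/-- The load a row type records (`0` unless algebraic). -/
def RowTypeX.load : RowTypeX → ℕ
  | .algebraic l => l
  | _ => 0

/-- Crossing weight of an affine support `U` at typing `τ`: the combinatorial rows it touches. -/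
def affWeight (U : Finset (Fin m × Fin n)) (τ : Fin m → RowTypeX) : ℕ :=
  ((eqRows U).filter fun i => τ i = RowTypeX.combinatorial).card

/-- Retyping below an affine node: touched non-combinatorial rows become algebraic with load `+1`;
touched combinatorial rows STAY combinatorial (the adversary decouples the equation from them). -/
def retagX (U : Finset (Fin m × Fin n)) (τ : Fin m → RowTypeX) : Fin m → RowTypeX :=
  fun i => if i ∈ eqRows U then
    (if τ i = RowTypeX.combinatorial then RowTypeX.combinatorial else RowTypeX.algebraic ((τ i).load + 1))
    else τ i

/-- One node of `LRX`: a label test (weight `0`), an affine test (weight = number of combinatorial rows its support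
touches — type-A crossings), or a single-row test on ANY row (weight `0` — type B is free; the row becomes
combinatorial).  `NodeOKX g τ s τ' w`: test `s` is legal at typing `τ`, `τ'` is the typing below it, `w` its weight.
(The load recorded in `algebraic λ` is not used by the weights; it is kept because the adversary's type-B move and
the hypothesis `SubspaceHard` are indexed by it.) -/
def NodeOKX (g : (Fin n → Bool) → Bool) (τ : Fin m → RowTypeX) (s : (Fin m × Fin n → Bool) → Bool)
    (τ' : Fin m → RowTypeX) (w : ℕ) : Prop :=
  (IsLabelTest g s ∧ τ' = τ ∧ w = 0) ∨
  (∃ (U : Finset (Fin m × Fin n)) (c : Bool), (∀ X, s X = Bool.xor c (parityOn U X)) ∧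
      τ' = retagX U τ ∧ w = affWeight U τ) ∨
  (∃ (i : Fin m) (ψ : (Fin n → Bool) → Bool), (∀ X, s X = ψ (row X i)) ∧
      τ' = Function.update τ i RowTypeX.combinatorial ∧ w = 0)

/-- **Class LRX_t** relative to a typing: total crossing weight `≤ t` along every root–leaf path. -/
def LRXDisciplinedOn (g : (Fin n → Bool) → Bool) :
    ℕ → (Fin m → RowTypeX) → KWTree (Fin m × Fin n) → Prop
  | _, _, .leaf _ => True
  | t, τ, .alice s P Q => ∃ (τ' : Fin m → RowTypeX) (w : ℕ), NodeOKX g τ s τ' w ∧ w ≤ t ∧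
      LRXDisciplinedOn g (t - w) τ' P ∧ LRXDisciplinedOn g (t - w) τ' Q
  | t, τ, .bob s P Q => ∃ (τ' : Fin m → RowTypeX) (w : ℕ), NodeOKX g τ s τ' w ∧ w ≤ t ∧
      LRXDisciplinedOn g (t - w) τ' P ∧ LRXDisciplinedOn g (t - w) τ' Q

/-- `LRX_t` from the all-`fresh` typing. -/
def LRXDisciplined (g : (Fin n → Bool) → Bool) (t : ℕ) (P : KWTree (Fin m × Fin n)) : Prop :=
  LRXDisciplinedOn g t (fun _ => RowTypeX.fresh) P

/-- **Class LRB** = `LRX_0`: per row, equations first and single-row tests after, never an equation through a row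
already cut by a single-row test.  `LRAD ⊆ LRB` (an LRAD typing has weight `0` at every node). -/
def LRBDisciplined (g : (Fin n → Bool) → Bool) (P : KWTree (Fin m × Fin n)) : Prop := LRXDisciplined g 0 P

end Crossing

/-! ## The rungs and the candidate stubs -/

/-- **Rung C1|LRB** (the NEXT rung; strictly between the proved `StrongCompositionLRAD` and C1|LRA): strong
composition with C1's own loss for every LRB protocol. -/
def StrongCompositionLRB : Prop :=
  ∃ c : ℕ, ∀ m n : ℕ, 1 ≤ n → ∀ f : (Fin m → Bool) → Bool, (∃ a b, f a ≠ f b) →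
    ∃ g : (Fin n → Bool) → Bool, ∀ P : KWTree (Fin m × Fin n),
      LRBDisciplined g P → P.SolvesStrong f g →
      ∃ Q : KWTree (Fin m), Q.Solves f ∧ Q.depth + n ≤ P.depth + c * (Nat.log 2 (m * n) + 1)

/-- **Rung C1|LRX** (one above): loss `c (log₂(m n) + 1) + t` for every `t`-crossing protocol; for
`t ≤ log₂(m n)` within C1's `O(log (m n))`. -/
def StrongCompositionLRX : Prop :=
  ∃ c : ℕ, ∀ m n : ℕ, 1 ≤ n → ∀ f : (Fin m → Bool) → Bool, (∃ a b, f a ≠ f b) →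
    ∃ g : (Fin n → Bool) → Bool, ∀ (t : ℕ) (P : KWTree (Fin m × Fin n)),
      LRXDisciplined g t P → P.SolvesStrong f g →
      ∃ Q : KWTree (Fin m), Q.Solves f ∧ Q.depth + n ≤ P.depth + c * (Nat.log 2 (m * n) + 1) + t

/-- **Candidate stub 1 — `LRBQuantitative`** (the shape of the PROVED `LRADQuantitative` with the class widened to
LRB and ONE new hypothesis, `SubspaceHard g q`): every LRB protocol for the strong game of a non-constant `f`
(label rectangle of hardness `ℓ`) against a per-row label-universal, affinely generic, subspace-hard `g` has depth
`≥ ℓ + (q − 1) − 2`.  What `InvOnE` lacks for it (memo §6.0): (L1) the equation-SPLITTING lemma (Sat-set and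
per-row loads preserved), (L2) the internal-to-row-set MOVE (`AE` unchanged by `AffGeneric`; row game of the
retyped row `Hard` by `SubspaceHard`; `K ↦ min K k`), (L3) loads in the typing.  Size M–L on top of the LRAD
proof.  The rung follows as `strongCompositionLRAD_of_quantitative` does, with S0⁺ in place of S0. -/
def LRBQuantitative : Prop :=
  ∀ (m n q r ℓ : ℕ) (f : (Fin m → Bool) → Bool) (g : (Fin n → Bool) → Bool),
    (∃ a b, f a = true ∧ f b = false) →
    AffGeneric g r → q + r + 1 ≤ n → SubspaceHard g q → PerRowLU g m q → 1 ≤ q →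
    Hard (f ⁻¹' {true}) (f ⁻¹' {false}) ℓ →
    ∀ P : KWTree (Fin m × Fin n), LRBDisciplined g P → P.SolvesStrong f g →
      ℓ + (q - 1) ≤ P.depth + 2

/-- **Candidate stub 2 — `LRXQuantitative`** (one above: the type-A allowance `t`, one extra unit per
combinatorial row an affine test touches; needs in addition (L4) the DECOUPLING step = an M3 row step with an
affine `ψ` on the combinatorial row followed by an LRAD affine step, and the slack `t` threaded through the
induction). -/
def LRXQuantitative : Prop :=
  ∀ (m n q r ℓ t : ℕ) (f : (Fin m → Bool) → Bool) (g : (Fin n → Bool) → Bool),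
    (∃ a b, f a = true ∧ f b = false) →
    AffGeneric g r → q + r + 1 ≤ n → SubspaceHard g q → PerRowLU g m q → 1 ≤ q →
    Hard (f ⁻¹' {true}) (f ⁻¹' {false}) ℓ →
    ∀ P : KWTree (Fin m × Fin n), LRXDisciplined g t P → P.SolvesStrong f g →
      ℓ + (q - 1) ≤ P.depth + 2 + t

end Summit.PneNP.PneNP.Cruxes.StrongComposition.P4g19X
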